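import Summits.HubbardSuperconductivity.HubbardSuperconductivity.Theses.PlaquetteBoson
import Summits.HubbardSuperconductivity.HubbardSuperconductivity.Theses.LevyLogBootstrap
import Summits.HubbardSuperconductivity.HubbardSuperconductivity.Theorems.TwTipContinuation.Negative.TipNormalForm
import Summits.HubbardSuperconductivity.HubbardSuperconductivity.Theorems.CooperPairDMottWalkBreathingAtOneIsPure
import Literature.Barriers.HubbardSuperconductivity.PureModelStripeCompetition
import HarnessLib

/-!
# Crux `PbContinuation` (stmt-HubbardSuperconductivity-0907) — STRATEGY-CENSUS sketch (crux-strategist)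

Sorry-free companion of `STRATEGY-CENSUS.md` (planner `cstrat-stmt-HubbardSuperconductivity-0907-s2`,
2026-08-17). It does NOT restate the crux and is NOT a line; it records, over the literal route terms:

* the POINTWISE NORMAL FORM of the crux: `PbContinuation ↔ ∀ U>0 ∀ δ∈(0,1/2), AnchorAt U δ → SummitAt U δ`
  (`Iff.rfl`), with `SummitAt U δ ↔ EveryGSOrderEven U δ` (landed `summitMatrix_iff_everyGSOrder`) and
  `LevyLogBootstrap.Continuation ↔ PlaquetteBoson.PbContinuation` (`Iff.rfl`, one shared item);
* NEGATION normal form: `¬ PbContinuation ↔ ∃ U δ, 0<U ∧ δ∈(0,1/2) ∧ AnchorAt U δ ∧ ¬ SummitAt U δ`, and the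
  typed CORNER lemma `not_pbContinuation_of_corner` (anchor lit + pure torus dark at ONE admissible `(U,δ)`
  refutes the crux) — the census argues this is the EXPECTED situation at `U ≤ 4`, `δ ∈ (2/5,1/2)`
  (`d_xy`, Deng–Kozik–Prokof'ev–Svistunov 2015, arXiv:1408.2088 p.2);
* the candidate RESTATEMENTS the census recommends to the tenure planner (all strictly weaker than the crux,
  none filed by this seat): `PbContinuationOn W` (window), `PbContinuationAt U δ` (two-place),
  `PbContinuationWalk I δ₀` (∃-endpoint walk, the typing of `CooperPairDMottWalk.BindingWalk`),
  `PbContinuationRay I δ₀` (∃-terminus on the two-tiling ray `[U₀,2U₀]`, after crux idea `two-tiling-ray`) and the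
  weakest `PbContinuationE` ((∃ anchor) → (∃ summit point)), with the PROVED facts that each still decides
  the sub-problem together with the other items of route `LevyLogBootstrap` (`closesE`, `closesW`,
  `closesWalk`, `closesRay`) and that `PbContinuationE` is summit-implied (`pbContinuationE_of_summit`), hence not
  expected-false;
* the signatures attempted under the census headings Transfer / Strengthen / Decomposition (`checker`,
  `UniformWalk`, `UniformWalkIco`, `EndpointClosure`, `MonotoneWalk`, `UniqueAtOne`, `CertifiedAt`) as
  elaborating `Prop`s, plus the two seams that ARE provable bookkeeping (`everyGSOrderFour_of_uniformWalk`,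
  `checker_one`).

No new Literature definition; every constant is an existing declaration. [folklore]
-/

noncomputable section

-- `dupNamespace`: the summit and the problem are both named `HubbardSuperconductivity` (layout D-0022)
set_option linter.dupNamespace false

namespace Summit.HubbardSuperconductivity.HubbardSuperconductivity.Cruxes.PbContinuation.Census

open Matrix Filter
open Literature.Probability.LatticeModels Literature.MathematicalPhysics.QuantumLattice
open Summit.HubbardSuperconductivity.HubbardSuperconductivity.Theses.PlaquetteBoson (PbContinuation PbAnchorOrder)
open Summit.HubbardSuperconductivity.HubbardSuperconductivity.Theses.LevyLogBootstrap
  (Block2InfDivXXZ LevyTransport DressHalfFilled Continuation HalfFilledOrder)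
open Summit.HubbardSuperconductivity.TwTipContinuation.Negative (summitMatrix_iff_everyGSOrder)
open Literature.Barriers.HubbardSuperconductivity (HasDWavePairFieldLROAt PureModelStripeCompetition)

/-! ## The objects of the crux, named -/

/-- The checkerboard (plaquette / breathing) Hubbard torus `H_L(t',U)`: 2×2 plaquettes with hopping `1`
and on-site `U`, glued by inter-plaquette hopping `t'` (no second `U`). [folklore] -/
def checker (L : ℕ) [NeZero L] (t' U : ℝ) :=
  hamiltonian ((fermionTorusGraph 2 L) \ SimpleGraph.comap
      (fun x : FermionTorus 2 L => fun i : Fin 2 => ((ofLex x) i : ℕ) / 2) ⊤) 1 U +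
    hamiltonian ((fermionTorusGraph 2 L) ⊓ SimpleGraph.comap
      (fun x : FermionTorus 2 L => fun i : Fin 2 => ((ofLex x) i : ℕ) / 2) ⊤) t' 0

/-- ENDPOINT IDENTITY: `H_L(1,U)` is the pure Hubbard torus (edge partition, landed
`hamiltonian_sdiff_add_inf`). [folklore] -/
theorem checker_one (L : ℕ) [NeZero L] (U : ℝ) : checker L 1 U = hubbardTorus 2 L 1 U :=
  Summit.HubbardSuperconductivity.HubbardSuperconductivity.Theorems.CooperPairDMottWalk.hamiltonian_sdiff_add_inf
    _ _ 1 U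

/-- The ANCHOR body at `(U,δ)` (verbatim hypothesis of the crux): small-`t'` every-ground-state
`d_{x²-y²}` pair-field order of the checkerboard tori with `4 ∣ L`. [folklore] -/
def AnchorAt (U δ : ℝ) : Prop :=
  ∃ t₀ : ℝ, 0 < t₀ ∧ ∀ t' ∈ Set.Ioo (0:ℝ) t₀, ∃ c : ℝ, 0 < c ∧ ∃ L₀ : ℕ, ∀ (L : ℕ) [NeZero L],
    L₀ ≤ L → 4 ∣ L → ∀ (N : ℕ) (ψ : Fock (Orb (FermionTorus 2 L))),
      N = 2 * ⌊(1 - δ) * (L : ℝ) ^ 2 / 2⌋₊ → star ψ ⬝ᵥ ψ = 1 →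
      IsGroundStateInSector
        (hamiltonian ((fermionTorusGraph 2 L) \ SimpleGraph.comap
            (fun x : FermionTorus 2 L => fun i : Fin 2 => ((ofLex x) i : ℕ) / 2) ⊤) 1 U +
          hamiltonian ((fermionTorusGraph 2 L) ⊓ SimpleGraph.comap
            (fun x : FermionTorus 2 L => fun i : Fin 2 => ((ofLex x) i : ℕ) / 2) ⊤) t' 0) N 0 ψ →
      c * (L : ℝ) ^ 4 ≤ (expect ((pairField dWaveFormFactor L)ᴴ * pairField dWaveFormFactor L) ψ).re

/-- The SUMMIT MATRIX at `(U,δ)` (verbatim conclusion of the crux = the summit's body at `(U,δ)`) is the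
catalogued `Literature.Barriers.HubbardSuperconductivity.HasDWavePairFieldLROAt U δ`; we use that
declaration under a short local name. [folklore] -/
abbrev SummitAt (U δ : ℝ) : Prop := HasDWavePairFieldLROAt U δ

/-- Eventual, uniform, every-GS order bound of the PURE torus along even sides. [folklore] -/
def EveryGSOrderEven (U δ : ℝ) : Prop :=
  ∃ c : ℝ, 0 < c ∧ ∃ L₀ : ℕ, ∀ (L : ℕ) [NeZero L], L₀ ≤ L → Even L →
    ∀ ψ : Fock (Orb (FermionTorus 2 L)), star ψ ⬝ᵥ ψ = 1 →
      IsGroundStateInSector (hubbardTorus 2 L 1 U) (2 * ⌊(1 - δ) * (L : ℝ) ^ 2 / 2⌋₊) 0 ψ →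
        c * (L : ℝ) ^ 4 ≤ (expect ((pairField dWaveFormFactor L)ᴴ * pairField dWaveFormFactor L) ψ).re

/-- The same bound along the anchor's sides `4 ∣ L` only (conclusion of `stub_noTransition`). [folklore] -/
def EveryGSOrderFour (U δ : ℝ) : Prop :=
  ∃ c : ℝ, 0 < c ∧ ∃ L₀ : ℕ, ∀ (L : ℕ) [NeZero L], L₀ ≤ L → 4 ∣ L →
    ∀ ψ : Fock (Orb (FermionTorus 2 L)), star ψ ⬝ᵥ ψ = 1 →
      IsGroundStateInSector (hubbardTorus 2 L 1 U) (2 * ⌊(1 - δ) * (L : ℝ) ^ 2 / 2⌋₊) 0 ψ →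
        c * (L : ℝ) ^ 4 ≤ (expect ((pairField dWaveFormFactor L)ᴴ * pairField dWaveFormFactor L) ψ).re

/-! ## Normal forms -/

/-- **Pointwise normal form of the crux** (definitional). [folklore] -/
theorem pbContinuation_iff_pointwise :
    PbContinuation ↔ ∀ U δ : ℝ, 0 < U → δ ∈ Set.Ioo (0:ℝ) (1/2) → AnchorAt U δ → SummitAt U δ :=
  Iff.rfl

/-- The `LevyLogBootstrap` copy of the shared item is the same proposition (definitional). [folklore] -/
theorem continuation_iff_pbContinuation : Continuation ↔ PbContinuation := Iff.rfl

/-- `PbAnchorOrder` is "the anchor holds SOMEWHERE" (definitional). [folklore] -/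
theorem pbAnchorOrder_iff :
    PbAnchorOrder ↔ ∃ U : ℝ, 0 < U ∧ ∃ δ ∈ Set.Ioo (0:ℝ) (1/2), AnchorAt U δ := Iff.rfl

/-- The summit is "the summit matrix holds SOMEWHERE" (definitional). [folklore] -/
theorem summit_iff_exists :
    HubbardSuperconductivity ↔ ∃ U : ℝ, 0 < U ∧ ∃ δ ∈ Set.Ioo (0:ℝ) (1/2), SummitAt U δ := Iff.rfl

/-- The summit matrix at `(U,δ)` IS the every-GS order bound along even sides (landed normal form). [folklore] -/
theorem summitAt_iff_everyGSOrderEven {U δ : ℝ} (hδ : -1 ≤ δ) : SummitAt U δ ↔ EveryGSOrderEven U δ :=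
  summitMatrix_iff_everyGSOrder hδ

/-- Restriction of the even-side bound to the `4 ∣ L` sides. [folklore] -/
theorem everyGSOrderFour_of_even {U δ : ℝ} : EveryGSOrderEven U δ → EveryGSOrderFour U δ := by
  rintro ⟨c, hc, L₀, h⟩
  refine ⟨c, hc, L₀, fun L _ hL h4 ψ hψ hgs => h L hL ?_ ψ hψ hgs⟩
  obtain ⟨m, rfl⟩ := h4
  exact ⟨2 * m, by ring⟩

/-! ## Negation normal form and the CORNER lemma -/

/-- **What a refutation needs**: ONE admissible `(U,δ)` where the anchor is lit and the pure torus is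
dark. [folklore] -/
theorem not_pbContinuation_iff :
    ¬ PbContinuation ↔
      ∃ U δ : ℝ, 0 < U ∧ δ ∈ Set.Ioo (0:ℝ) (1/2) ∧ AnchorAt U δ ∧ ¬ SummitAt U δ := by
  rw [pbContinuation_iff_pointwise]
  push Not
  rfl

/-- **Corner lemma** (order-bound form): anchor lit at `(U,δ)` and NO uniform every-GS `d_{x²-y²}` bound for
the pure torus at the same `(U,δ)` refute the crux. The census's expected instance: `U ≤ 4`,
`δ ∈ (2/5, 1/2)` — plaquette pair binding + dilute B1g plaquette-pair condensate at small `t'` versus a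
`d_xy` (not `d_{x²-y²}`) weak-coupling ground state of the uniform model below `n ≈ 0.6`
(arXiv:1408.2088 p.2). Both conjuncts are open, so this is an EXPECTED, not a formal, refutation. [folklore] -/
theorem not_pbContinuation_of_corner {U δ : ℝ} (hU : 0 < U) (hδ : δ ∈ Set.Ioo (0:ℝ) (1/2))
    (hA : AnchorAt U δ) (hD : ¬ EveryGSOrderEven U δ) : ¬ PbContinuation := fun h =>
  hD ((summitAt_iff_everyGSOrderEven (by linarith [hδ.1])).1 (h U δ hU hδ hA))

/-- The corner instance the census names, as one closed proposition (`U = 2`, `δ = 9/20`, density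
`n = 0.55`). [folklore] -/
def CornerWitness : Prop := AnchorAt 2 (9/20) ∧ ¬ EveryGSOrderEven 2 (9/20)

/-- The named corner refutes the crux. [folklore] -/
theorem not_pbContinuation_of_cornerWitness (h : CornerWitness) : ¬ PbContinuation :=
  not_pbContinuation_of_corner (by norm_num) (by constructor <;> norm_num) h.1 h.2

/-- The CATALOGUED no-go `PureModelStripeCompetition` (= `¬ HasDWavePairFieldLROAt 8 (1/8)`, Qin et al.
2020, an OPEN conjecture in `Literature/Barriers`) bites the crux only TOGETHER with an anchor at
`(8, 1/8)` — which the plaquette dictionary does not supply (`U = 8 > U_c ≈ 4.6`: no plaquette pair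
binding, YTK 2007 p.2). Recorded to show which barrier instance the ∀-typing exposes. [folklore] -/
theorem not_pbContinuation_of_stripe (hS : PureModelStripeCompetition) (hA : AnchorAt 8 (1/8)) :
    ¬ PbContinuation := fun h =>
  hS (h 8 (1/8) (by norm_num) (by constructor <;> norm_num) hA)

/-! ## Candidate restatements (strictly weaker; recommended to tenure, NOT filed by this seat) -/

/-- R2 — two-place form. [folklore] -/
def PbContinuationAt (U δ : ℝ) : Prop := AnchorAt U δ → SummitAt U δ

/-- R3 — windowed form. [folklore] -/
def PbContinuationOn (W : Set (ℝ × ℝ)) : Prop :=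
  ∀ U δ : ℝ, (U, δ) ∈ W → 0 < U → δ ∈ Set.Ioo (0:ℝ) (1/2) → AnchorAt U δ → SummitAt U δ

/-- R1 — the weakest form that still closes every route using the item: anchor SOMEWHERE ⇒ summit
matrix SOMEWHERE. [folklore] -/
def PbContinuationE : Prop :=
  (∃ U : ℝ, 0 < U ∧ ∃ δ ∈ Set.Ioo (0:ℝ) (1/2), AnchorAt U δ) →
    ∃ U : ℝ, 0 < U ∧ ∃ δ ∈ Set.Ioo (0:ℝ) (1/2), SummitAt U δ

/-- R4 — ∃-endpoint WALK (typing of `CooperPairDMottWalk.BindingWalk`): anchor on a whole segment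
`I × {δ₀}` ⇒ summit matrix at SOME admissible point. [folklore] -/
def PbContinuationWalk (I : Set ℝ) (δ₀ : ℝ) : Prop :=
  (∀ U ∈ I, AnchorAt U δ₀) → ∃ U : ℝ, 0 < U ∧ ∃ δ ∈ Set.Ioo (0:ℝ) (1/2), SummitAt U δ

/-- R5 — RAY / free-terminus form at fixed doping (the ∃-terminus version of crux idea `two-tiling-ray`,
ideator planner-cruxidea-…-0907-1-0: the exact identity `H_A(1,t',U₀) + H_B(1,t',U₀) = (1+t')·H_unif(2U₀/(1+t'))`
attaches to the anchor at `U₀` the uniform models on the ray `[U₀, 2U₀]`; the summit's `∃ U` lets the route end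
anywhere on it). [folklore] -/
def PbContinuationRay (I : Set ℝ) (δ₀ : ℝ) : Prop :=
  ∀ U₀ ∈ I, AnchorAt U₀ δ₀ → ∃ U₁ ∈ Set.Icc U₀ (2 * U₀), SummitAt U₁ δ₀

/-- `PbContinuationOn univ` is the crux. [folklore] -/
theorem pbContinuationOn_univ : PbContinuationOn Set.univ ↔ PbContinuation :=
  ⟨fun h U δ hU hδ hA => h U δ trivial hU hδ hA, fun h U δ _ hU hδ hA => h U δ hU hδ hA⟩

/-- Windows are monotone. [folklore] -/
theorem pbContinuationOn_mono {W W' : Set (ℝ × ℝ)} (hW : W ⊆ W') :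
    PbContinuationOn W' → PbContinuationOn W := fun h U δ hm => h U δ (hW hm)

/-- crux ⇒ every window. [folklore] -/
theorem pbContinuationOn_of_pbContinuation (W : Set (ℝ × ℝ)) :
    PbContinuation → PbContinuationOn W := fun h U δ _ => h U δ

/-- crux ⇒ two-place form everywhere. [folklore] -/
theorem pbContinuationAt_of_pbContinuation {U δ : ℝ} (hU : 0 < U) (hδ : δ ∈ Set.Ioo (0:ℝ) (1/2)) :
    PbContinuation → PbContinuationAt U δ := fun h => h U δ hU hδ

/-- crux ⇒ R1. [folklore] -/
theorem pbContinuationE_of_pbContinuation : PbContinuation → PbContinuationE :=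
  fun h ⟨U, hU, δ, hδ, hA⟩ => ⟨U, hU, δ, hδ, h U δ hU hδ hA⟩

/-- window containing an anchored segment point ⇒ walk. [folklore] -/
theorem pbContinuationWalk_of_on {I : Set ℝ} {δ₀ U₀ : ℝ} (hδ₀ : δ₀ ∈ Set.Ioo (0:ℝ) (1/2))
    (hU₀ : U₀ ∈ I) (hU₀pos : 0 < U₀) (h : PbContinuationOn (I ×ˢ {δ₀})) :
    PbContinuationWalk I δ₀ := fun hA =>
  ⟨U₀, hU₀pos, δ₀, hδ₀, h U₀ δ₀ ⟨hU₀, Set.mem_singleton _⟩ hU₀pos hδ₀ (hA U₀ hU₀)⟩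

/-- crux ⇒ R5 on any window of positive couplings inside the admissible doping (terminus `U₁ = U₀`). [folklore] -/
theorem pbContinuationRay_of_pbContinuation {I : Set ℝ} {δ₀ : ℝ} (hI : ∀ U ∈ I, 0 < U)
    (hδ₀ : δ₀ ∈ Set.Ioo (0:ℝ) (1/2)) : PbContinuation → PbContinuationRay I δ₀ :=
  fun h U₀ hU₀ hA => ⟨U₀, ⟨le_rfl, by linarith [hI U₀ hU₀]⟩, h U₀ δ₀ (hI U₀ hU₀) hδ₀ hA⟩

/-- **R1 is summit-implied** — so, unlike the crux, it has no expected-false instance. [folklore] -/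
theorem pbContinuationE_of_summit : HubbardSuperconductivity → PbContinuationE := fun h _ => h

/-- Given the anchor somewhere (e.g. `PbAnchorOrder`), R1 is EQUIVALENT to the summit: it is exactly
"the rest of the work". [folklore] -/
theorem pbContinuationE_iff_summit_of_anchor
    (hA : ∃ U : ℝ, 0 < U ∧ ∃ δ ∈ Set.Ioo (0:ℝ) (1/2), AnchorAt U δ) :
    PbContinuationE ↔ HubbardSuperconductivity :=
  ⟨fun h => h hA, fun h _ => h⟩

/-! ## Each restatement still DECIDES the sub-problem with the other items of `LevyLogBootstrap` -/

/-- Route `PlaquetteBoson`: `closes` with R1 in place of `PbContinuation`. The same one-liner serves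
`PolyaSchurPairBoson` (`hE (hD hT)`) and `AnisotropyChord` (through its `Assembly` item), whose dressing
items all conclude `∃ U > 0, ∃ δ ∈ (0,1/2), AnchorAt U δ`. [folklore] -/
theorem closesE_plaquetteBoson (hA : PbAnchorOrder) (hE : PbContinuationE) : HubbardSuperconductivity :=
  hE hA

/-- Route `LevyLogBootstrap`: `closes` with R1 in place of `Continuation` (other three items verbatim). [folklore] -/
theorem closesE (h1 : Block2InfDivXXZ) (h2 : LevyTransport) (h3 : DressHalfFilled)
    (h4 : PbContinuationE) : HubbardSuperconductivity :=
  h4 (h3 (h2 h1))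

/-- `closes` with the WINDOW `W = [1,2] × {1/4}` and the dressing crux landing in the window
(`DressHalfFilled` restated to its intended output `U₀ ∈ [1,2]`, `δ = 1/4`). [folklore] -/
theorem closesW (h1 : Block2InfDivXXZ) (h2 : LevyTransport)
    (h3W : HalfFilledOrder → ∃ U ∈ Set.Icc (1:ℝ) 2, AnchorAt U (1/4))
    (h4W : PbContinuationOn (Set.Icc (1:ℝ) 2 ×ˢ {(1/4 : ℝ)})) : HubbardSuperconductivity := by
  obtain ⟨U, hU, hA⟩ := h3W (h2 h1)
  have hUpos : 0 < U := by linarith [hU.1]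
  have hδ : (1/4 : ℝ) ∈ Set.Ioo (0:ℝ) (1/2) := by constructor <;> norm_num
  exact ⟨U, hUpos, 1/4, hδ, h4W U (1/4) ⟨hU, Set.mem_singleton _⟩ hUpos hδ hA⟩

/-- `closes` with the ∃-endpoint WALK on the segment `[1,2] × {1/4}` (dressing crux restated to anchor the
whole segment). [folklore] -/
theorem closesWalk (h1 : Block2InfDivXXZ) (h2 : LevyTransport)
    (h3I : HalfFilledOrder → ∀ U ∈ Set.Icc (1:ℝ) 2, AnchorAt U (1/4))
    (h4 : PbContinuationWalk (Set.Icc (1:ℝ) 2) (1/4)) : HubbardSuperconductivity :=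
  h4 (h3I (h2 h1))

/-- `closes` with the RAY form on `[1,2] × {1/4}` (dressing crux restated to land in `[1,2]`; terminus `U₁ ∈ [U₀,2U₀]`
chosen by the continuation prover). [folklore] -/
theorem closesRay (h1 : Block2InfDivXXZ) (h2 : LevyTransport)
    (h3W : HalfFilledOrder → ∃ U ∈ Set.Icc (1:ℝ) 2, AnchorAt U (1/4))
    (h4 : PbContinuationRay (Set.Icc (1:ℝ) 2) (1/4)) : HubbardSuperconductivity := by
  obtain ⟨U₀, hU₀, hA⟩ := h3W (h2 h1)
  obtain ⟨U₁, hU₁, hS⟩ := h4 U₀ hU₀ hA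
  have hU₁pos : 0 < U₁ := by linarith [hU₀.1, hU₁.1]
  have hδ : (1/4 : ℝ) ∈ Set.Ioo (0:ℝ) (1/2) := by constructor <;> norm_num
  exact ⟨U₁, hU₁pos, 1/4, hδ, hS⟩

/-! ## Signatures attempted under Transfer / Strengthen / Decomposition (statements only) -/

/-- STRENGTHEN S⁺₁ — UNIFORM WALK on the closed path: one constant for every `t' ∈ [t₁, 1]`, `4 ∣ L`.
Contains `t' = 1`, hence implies `EveryGSOrderFour` outright (costume risk as a stub) and is at least as
false as the crux at the corner. [folklore] -/
def UniformWalk (U δ : ℝ) : Prop :=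
  ∃ t₁ ∈ Set.Ioo (0:ℝ) 1, ∃ c : ℝ, 0 < c ∧ ∃ L₀ : ℕ, ∀ (L : ℕ) [NeZero L], L₀ ≤ L → 4 ∣ L →
    ∀ t' ∈ Set.Icc t₁ 1, ∀ ψ : Fock (Orb (FermionTorus 2 L)), star ψ ⬝ᵥ ψ = 1 →
      IsGroundStateInSector (checker L t' U) (2 * ⌊(1 - δ) * (L : ℝ) ^ 2 / 2⌋₊) 0 ψ →
        c * (L : ℝ) ^ 4 ≤ (expect ((pairField dWaveFormFactor L)ᴴ * pairField dWaveFormFactor L) ψ).re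

/-- The closed uniform walk gives the `4 ∣ L` endpoint bound by SPECIALISATION at `t' = 1` and the endpoint
identity — i.e. as a stub it would be the crux's conclusion plus decoration. [folklore] -/
theorem everyGSOrderFour_of_uniformWalk {U δ : ℝ} : UniformWalk U δ → EveryGSOrderFour U δ := by
  rintro ⟨t₁, ht₁, c, hc, L₀, h⟩
  refine ⟨c, hc, L₀, fun L _ hL h4 ψ hψ hgs => h L hL h4 1 ⟨ht₁.2.le, le_rfl⟩ ψ hψ ?_⟩
  rwa [checker_one]

/-- STRENGTHEN S⁺₁' — uniform walk on the HALF-OPEN path `[t₁, 1)`: no longer contains the endpoint. [folklore] -/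
def UniformWalkIco (U δ : ℝ) : Prop :=
  ∃ t₁ ∈ Set.Ioo (0:ℝ) 1, ∃ c : ℝ, 0 < c ∧ ∃ L₀ : ℕ, ∀ (L : ℕ) [NeZero L], L₀ ≤ L → 4 ∣ L →
    ∀ t' ∈ Set.Ico t₁ 1, ∀ ψ : Fock (Orb (FermionTorus 2 L)), star ψ ⬝ᵥ ψ = 1 →
      IsGroundStateInSector (checker L t' U) (2 * ⌊(1 - δ) * (L : ℝ) ^ 2 / 2⌋₊) 0 ψ →
        c * (L : ℝ) ^ 4 ≤ (expect ((pairField dWaveFormFactor L)ᴴ * pairField dWaveFormFactor L) ψ).re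

/-- TRANSFER T4 (sibling `TwTipContinuation`, `CornerDanskin.existsGSOrder_pure_of_uniformRungs`): ENDPOINT
CLOSURE — uniform every-GS order on `[t₁,1)` gives SOME ordered ground state of the pure torus at each large
`L` (continuity of `t' ↦ checker L t' U` + compactness of the unit sphere; provable now, M-sized). Only an
`∃`-GS conclusion: the every-GS upgrade at the endpoint is exactly what `not_abstractUniformRungsShape`
shows cannot come from bookkeeping. [folklore] -/
def EndpointClosure (U δ : ℝ) : Prop :=
  UniformWalkIco U δ →
    ∃ c : ℝ, 0 < c ∧ ∃ L₀ : ℕ, ∀ (L : ℕ) [NeZero L], L₀ ≤ L → 4 ∣ L →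
      ∃ ψ : Fock (Orb (FermionTorus 2 L)), star ψ ⬝ᵥ ψ = 1 ∧
        IsGroundStateInSector (hubbardTorus 2 L 1 U) (2 * ⌊(1 - δ) * (L : ℝ) ^ 2 / 2⌋₊) 0 ψ ∧
          c * (L : ℝ) ^ 4 ≤ (expect ((pairField dWaveFormFactor L)ᴴ * pairField dWaveFormFactor L) ψ).re

/-- DECOMPOSITION D4's third piece: UNIQUENESS of the pure-torus sector ground state at the dressed filling,
eventually in `L ∈ 4ℕ` (would upgrade `∃`-GS to every-GS at the endpoint; suspect at shell-degenerate
fillings, no tool). [folklore] -/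
def UniqueAtOne (U δ : ℝ) : Prop :=
  ∃ L₀ : ℕ, ∀ (L : ℕ) [NeZero L], L₀ ≤ L → 4 ∣ L →
    ∀ ψ φ : Fock (Orb (FermionTorus 2 L)),
      IsGroundStateInSector (hubbardTorus 2 L 1 U) (2 * ⌊(1 - δ) * (L : ℝ) ^ 2 / 2⌋₊) 0 ψ →
      IsGroundStateInSector (hubbardTorus 2 L 1 U) (2 * ⌊(1 - δ) * (L : ℝ) ^ 2 / 2⌋₊) 0 φ →
        ∃ a : ℂ, φ = a • ψ

/-- STRENGTHEN S⁺₂ — MONOTONE WALK (Griffiths-type): the worst-GS order is non-decreasing in `t' ∈ (0,1]`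
at fixed `L`, typed without `min`: every GS at the larger coupling dominates some GS at the smaller one.
No correlation inequality of this kind is known for lattice fermions; DCA finds the order maximal at
`t' = 1` (Doluweera et al. 2008) but the corner forces failure somewhere on `(0,1]`. [folklore] -/
def MonotoneWalk (U δ : ℝ) : Prop :=
  ∀ (L : ℕ) [NeZero L], 4 ∣ L → ∀ t₁ t₂ : ℝ, 0 < t₁ → t₁ ≤ t₂ → t₂ ≤ 1 →
    ∀ φ : Fock (Orb (FermionTorus 2 L)), star φ ⬝ᵥ φ = 1 →
      IsGroundStateInSector (checker L t₂ U) (2 * ⌊(1 - δ) * (L : ℝ) ^ 2 / 2⌋₊) 0 φ →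
        ∃ ψ : Fock (Orb (FermionTorus 2 L)), star ψ ⬝ᵥ ψ = 1 ∧
          IsGroundStateInSector (checker L t₁ U) (2 * ⌊(1 - δ) * (L : ℝ) ^ 2 / 2⌋₊) 0 ψ ∧
            (expect ((pairField dWaveFormFactor L)ᴴ * pairField dWaveFormFactor L) ψ).re ≤
              (expect ((pairField dWaveFormFactor L)ᴴ * pairField dWaveFormFactor L) φ).re

/-- Monotone walk + anchor ⇒ the `4 ∣ L` endpoint bound (the glue of the S⁺₂ line; pure bookkeeping, so the
whole content would sit in `MonotoneWalk`). [folklore] -/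
theorem everyGSOrderFour_of_monotoneWalk {U δ : ℝ} (hM : MonotoneWalk U δ) (hA : AnchorAt U δ) :
    EveryGSOrderFour U δ := by
  obtain ⟨t₀, ht₀, hA⟩ := hA
  -- pick the rung t' = min (t₀/2) (1/2) ∈ (0,t₀) ∩ (0,1]
  set t' : ℝ := min (t₀ / 2) (1 / 2) with ht'
  have ht'pos : 0 < t' := lt_min (by linarith) (by norm_num)
  have ht'lt : t' < t₀ := lt_of_le_of_lt (min_le_left _ _) (by linarith)
  have ht'le : t' ≤ 1 := le_trans (min_le_right _ _) (by norm_num)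
  obtain ⟨c, hc, L₀, hL⟩ := hA t' ⟨ht'pos, ht'lt⟩
  refine ⟨c, hc, L₀, fun L _ hL₀ h4 φ hφ hgs => ?_⟩
  have hgs' : IsGroundStateInSector (checker L 1 U) (2 * ⌊(1 - δ) * (L : ℝ) ^ 2 / 2⌋₊) 0 φ := by
    rwa [checker_one]
  obtain ⟨ψ, hψ, hψgs, hle⟩ := hM L h4 t' 1 ht'pos ht'le le_rfl φ hφ hgs'
  exact (hL L hL₀ h4 _ ψ rfl hψ hψgs).trans hle

/-- DECOMPOSITION D3's certificate predicate: the implication is guarded by an extra, physically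
discriminating certificate `Cert U δ` ("the uniform model at `(U,δ)` is in the `d_{x²-y²}` phase" in some
checkable finite-size form). Whatever `Cert` is, the split `(A ∧ Cert → S) ∧ (A → Cert)` re-proves the crux,
so `A → Cert` inherits the corner. [folklore] -/
def CertifiedContinuation (Cert : ℝ → ℝ → Prop) : Prop :=
  (∀ U δ : ℝ, 0 < U → δ ∈ Set.Ioo (0:ℝ) (1/2) → AnchorAt U δ → Cert U δ → SummitAt U δ) ∧
    (∀ U δ : ℝ, 0 < U → δ ∈ Set.Ioo (0:ℝ) (1/2) → AnchorAt U δ → Cert U δ)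

/-- D3 glue (trivial): any certificate split re-proves the crux — hence cannot dodge the corner. [folklore] -/
theorem pbContinuation_of_certified (Cert : ℝ → ℝ → Prop) (h : CertifiedContinuation Cert) :
    PbContinuation := fun U δ hU hδ hA => h.1 U δ hU hδ hA (h.2 U δ hU hδ hA)

/-- D2 glue (trivial): a window and its complement re-prove the crux — so the complement piece carries the
corner whenever the window avoids it. [folklore] -/
theorem pbContinuation_of_window (W : Set (ℝ × ℝ)) (hin : PbContinuationOn W)
    (hout : PbContinuationOn Wᶜ) : PbContinuation := by
  intro U δ hU hδ hA
  by_cases hm : (U, δ) ∈ W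
  · exact hin U δ hm hU hδ hA
  · exact hout U δ hm hU hδ hA

end Summit.HubbardSuperconductivity.HubbardSuperconductivity.Cruxes.PbContinuation.Census

end
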